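import Literature.Geometry.Lorentzian.GaussianBeamCross
import HarnessLib

/-!
# Thin Gaussian beams: the cut-off amplitude in a tube around the geodesic
(trunk G08 = T-LORENTZ, geometric optics; namespace `Literature.Geometry.Lorentzian.GaussianBeam`)

Sbierski, Anal. PDE 8 (2015), §3 (Def. 3.1 / arXiv:1311.2477 Def. 2.1, p. 11: "`a_𝒩 = a · χ`
with `χ ≡ 1` near `γ` and `supp a_𝒩 ⊆ 𝒩`") and §4, proof of the theorem ("given `δ > 0`,
choose `𝒩₁(δ)` so small that `|Nφ₁(x) − Nφ₁|_{γ_τ}| ≤ δ` for `x ∈ Σ_τ ∩ 𝒩₁`, `0 ≤ τ ≤ T`"):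
this file constructs, for beam data `D : BeamData G V J` over `[0, T]`, an admissible
amplitude `A : BeamAmp D T` supported in an arbitrarily thin tube `{‖x⃗ − c(x⁰)‖ ≤ 2ρ}` over
`[−3η, T + 3η]`, hence inside any prescribed open neighbourhood of the curve, on which moreover
`|T − κ(x⁰)| ≤ δ` (thinness for the main term) and `Re ∂_{Z(x⁰)}φ ≥ ½` for the explicit
directions `Z = P⃗/|P⃗|²` (non-stationarity of `Re φ` for the cross term):

* `BeamData.norm_sub_X`, `exists_tube_radius` — `‖x − X(x⁰)‖ = ‖x⃗ − c(x⁰)‖`; a compact piece of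
  the curve inside an open set has a tube inside it;
* `BeamData.tubeAmp` — the amplitude `χ_T(x⁰) χ_ρ(x⃗ − c(x⁰)) A₀(x⁰)` (`ContDiffBump` cut-offs)
  as a `BeamAmp D T`, with `tsupport_tubeAmp_subset`;
* `BeamData.Zdir`, `re_fderiv_φ_X_Zdir` (`= 1` on the curve), and **`BeamData.exists_beamAmp`**:
  for every open `W ⊇ X([−3η, T+3η])` and `δ > 0` an admissible amplitude supported in `W` with
  the two thinness properties and bounded directions on `[0, T]`.

## References

* J. Sbierski, Anal. PDE 8 (2015) 1379–1420, §3 Def. 3.1 and §4 (proof of the theorem);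
  arXiv:1311.2477v2 Def. 2.1 (p. 11), §2.3 (pp. 15–17) (key `Sbierski2015`).
-/

noncomputable section

open Set Filter Complex MeasureTheory Metric
open scoped ContDiff Topology

namespace Literature.Geometry.Lorentzian

namespace GaussianBeam

open KerrSchild

/-! ### Geometry of the chart: distance to the curve -/

/-- `(t, y) − (t', y') = (t − t', y − y')`. [folklore] -/
theorem ofTimeSpace_sub (t t' : ℝ) (y y' : E3) :
    E4.ofTimeSpace t y - E4.ofTimeSpace t' y' = E4.ofTimeSpace (t - t') (y - y') := by
  ext i
  refine Fin.cases ?_ (fun j ↦ ?_) i <;> simp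

/-- `‖(0, v)‖ = ‖v‖`. [folklore] -/
theorem norm_ofTimeSpace_zero (v : E3) : ‖E4.ofTimeSpace 0 v‖ = ‖v‖ := by
  rw [EuclideanSpace.norm_eq, EuclideanSpace.norm_eq, Fin.sum_univ_succ]
  simp

namespace BeamData

variable {G : E4 → Fin 4 → Fin 4 → ℝ} {V : Set E4} {J : Set ℝ} (D : BeamData G V J)

/-- **The distance of a point of the chart to the curve point on its leaf**:
`‖x − X(x⁰)‖ = ‖x⃗ − c(x⁰)‖`. [folklore] -/
theorem norm_sub_X (x : E4) : ‖x - D.X (x 0)‖ = ‖E4.spatial x - D.c (x 0)‖ := by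
  have h : x - D.X (x 0) = E4.ofTimeSpace 0 (E4.spatial x - D.c (x 0)) := by
    ext i
    refine Fin.cases ?_ (fun j ↦ ?_) i
    · simp [BeamData.X]
    · simp [BeamData.X, E4.spatial_apply]
  rw [h, norm_ofTimeSpace_zero]

/-- **A compact piece of the curve inside an open set has a tube inside it**: if
`X([a, b]) ⊆ W`, `W` open, `[a, b] ⊆ J`, there is `ρ > 0` with
`{x⁰ ∈ [a, b], ‖x⃗ − c(x⁰)‖ ≤ 2ρ} ⊆ W`. [folklore] -/
theorem exists_tube_radius {a b : ℝ} (hab : Icc a b ⊆ J) {W : Set E4} (hW : IsOpen W)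
    (hXW : ∀ t ∈ Icc a b, D.X t ∈ W) :
    ∃ ρ : ℝ, 0 < ρ ∧ ∀ x : E4, x 0 ∈ Icc a b → ‖E4.spatial x - D.c (x 0)‖ ≤ 2 * ρ → x ∈ W := by
  have hK : IsCompact (D.X '' Icc a b) :=
    isCompact_Icc.image_of_continuousOn (D.contDiffOn_X.continuousOn.mono hab)
  have hKW : D.X '' Icc a b ⊆ W := by rintro _ ⟨t, ht, rfl⟩; exact hXW t ht
  obtain ⟨δ, hδ, hsub⟩ := hK.exists_cthickening_subset_open hW hKW
  refine ⟨δ / 2, by positivity, fun x hx0 hx ↦ hsub ?_⟩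
  refine Metric.mem_cthickening_of_dist_le x (D.X (x 0)) δ _ ⟨x 0, hx0, rfl⟩ ?_
  rw [dist_eq_norm, D.norm_sub_X]
  linarith

/-! ### The cut-off amplitude in a tube -/

/-- The time cut-off: `1` on `[−2η, T + 2η]`, supported in `(−3η, T + 3η)`. [cite: Sbierski2015, §3 Def. 3.1 (the cut-off `χ`)] -/
def timeCut {T η : ℝ} (hT : 0 ≤ T) (hη : 0 < η) : ContDiffBump (T / 2) where
  rIn := T / 2 + 2 * η
  rOut := T / 2 + 3 * η
  rIn_pos := by linarith
  rIn_lt_rOut := by linarith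

/-- The spatial cut-off: `1` on `‖v‖ ≤ ρ`, supported in `‖v‖ < 2ρ`. [cite: Sbierski2015, §3 Def. 3.1 (the cut-off `χ`)] -/
def spaceCut {ρ : ℝ} (hρ : 0 < ρ) : ContDiffBump (0 : E3) where
  rIn := ρ
  rOut := 2 * ρ
  rIn_pos := hρ
  rIn_lt_rOut := by linarith

/-- The time cut-off is `1` on `[−2η, T + 2η]`. [folklore] -/
theorem timeCut_eq_one {T η : ℝ} (hT : 0 ≤ T) (hη : 0 < η) {t : ℝ} (ht : t ∈ Icc (-(2 * η)) (T + 2 * η)) :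
    (timeCut hT hη : ℝ → ℝ) t = 1 := by
  apply (timeCut hT hη).one_of_mem_closedBall
  rw [mem_closedBall, Real.dist_eq, abs_le]
  change -(T / 2 + 2 * η) ≤ t - T / 2 ∧ t - T / 2 ≤ T / 2 + 2 * η
  exact ⟨by linarith [ht.1], by linarith [ht.2]⟩

/-- Where the time cut-off is nonzero, `t ∈ (−3η, T + 3η)`. [folklore] -/
theorem mem_Ioo_of_timeCut_ne_zero {T η : ℝ} (hT : 0 ≤ T) (hη : 0 < η) {t : ℝ}
    (ht : (timeCut hT hη : ℝ → ℝ) t ≠ 0) : t ∈ Ioo (-(3 * η)) (T + 3 * η) := by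
  have hmem : t ∈ Function.support (timeCut hT hη : ℝ → ℝ) := ht
  rw [(timeCut hT hη).support_eq, mem_ball, Real.dist_eq, abs_lt] at hmem
  change -(T / 2 + 3 * η) < t - T / 2 ∧ t - T / 2 < T / 2 + 3 * η at hmem
  exact ⟨by linarith [hmem.1], by linarith [hmem.2]⟩

/-- Where the spatial cut-off is nonzero, `‖v‖ < 2ρ`. [folklore] -/
theorem norm_lt_of_spaceCut_ne_zero {ρ : ℝ} (hρ : 0 < ρ) {v : E3} (hv : (spaceCut hρ : E3 → ℝ) v ≠ 0) :
    ‖v‖ < 2 * ρ := by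
  have hmem : v ∈ Function.support (spaceCut hρ : E3 → ℝ) := hv
  rw [(spaceCut hρ).support_eq, mem_ball, dist_zero_right] at hmem
  exact hmem

/-- The spatial cut-off is `1` on `‖v‖ ≤ ρ`. [folklore] -/
theorem spaceCut_eq_one {ρ : ℝ} (hρ : 0 < ρ) {v : E3} (hv : ‖v‖ ≤ ρ) : (spaceCut hρ : E3 → ℝ) v = 1 :=
  (spaceCut hρ).one_of_mem_closedBall (by rwa [mem_closedBall, dist_zero_right])

/-- **The real cut-off** `χ(x) = χ_T(x⁰) χ_ρ(x⃗ − c(x⁰))`. [cite: Sbierski2015, §3 Def. 3.1 (the cut-off `χ`)] -/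
def cutoff {T η ρ : ℝ} (hT : 0 ≤ T) (hη : 0 < η) (hρ : 0 < ρ) (x : E4) : ℝ :=
  (timeCut hT hη : ℝ → ℝ) (x 0) * (spaceCut hρ : E3 → ℝ) (E4.spatial x - D.c (x 0))

/-- **The tube** `{x⁰ ∈ [−3η, T + 3η], ‖x⃗ − c(x⁰)‖ ≤ 2ρ}`. [cite: Sbierski2015, §3 Def. 3.1 (`𝒩`)] -/
def tube (T η ρ : ℝ) : Set E4 :=
  {x : E4 | x 0 ∈ Icc (-(3 * η)) (T + 3 * η) ∧ ‖E4.spatial x - D.c (x 0)‖ ≤ 2 * ρ}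

/-- `c` is continuous on `J`. [folklore] -/
theorem continuousOn_c : ContinuousOn D.c J := ((contDiffOn_piLp 2).2 D.hc).continuousOn

/-- The tube is the continuous image of `[−3η, T+3η] × B̄(0, 2ρ)`, hence compact. [folklore] -/
theorem isCompact_tube {T η ρ : ℝ} (hJ : Icc (-(3 * η)) (T + 3 * η) ⊆ J) : IsCompact (D.tube T η ρ) := by
  have hc : ContinuousOn (fun q : ℝ × E3 ↦ E4.ofTimeSpace q.1 (D.c q.1 + q.2))
      (Icc (-(3 * η)) (T + 3 * η) ×ˢ closedBall (0 : E3) (2 * ρ)) := by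
    have hcc : ContinuousOn (fun q : ℝ × E3 ↦ D.c q.1) (Icc (-(3 * η)) (T + 3 * η) ×ˢ closedBall (0 : E3) (2 * ρ)) :=
      (D.continuousOn_c.mono hJ).comp continuous_fst.continuousOn fun q hq ↦ hq.1
    exact (contDiff_ofTimeSpace_uncurry (n := 0)).continuous.comp_continuousOn
      (continuousOn_fst.prodMk (hcc.add continuousOn_snd))
  have himage : D.tube T η ρ =
      (fun q : ℝ × E3 ↦ E4.ofTimeSpace q.1 (D.c q.1 + q.2)) ''
        (Icc (-(3 * η)) (T + 3 * η) ×ˢ closedBall (0 : E3) (2 * ρ)) := by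
    ext x
    constructor
    · intro hx
      refine ⟨(x 0, E4.spatial x - D.c (x 0)), ⟨hx.1, ?_⟩, ?_⟩
      · rw [mem_closedBall, dist_zero_right]; exact hx.2
      · simp only [add_sub_cancel]
        exact E4.ofTimeSpace_time_spatial x
    · rintro ⟨q, ⟨hq1, hq2⟩, rfl⟩
      rw [mem_closedBall, dist_zero_right] at hq2
      refine ⟨by simpa using hq1, ?_⟩
      simpa using hq2
  rw [himage]
  exact (isCompact_Icc.prod (isCompact_closedBall _ _)).image_of_continuousOn hc

/-- The tube lies in the slab over `J`. [folklore] -/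
theorem tube_subset_slab {T η ρ : ℝ} (hJ : Icc (-(3 * η)) (T + 3 * η) ⊆ J) :
    D.tube T η ρ ⊆ {x : E4 | x 0 ∈ J} := fun _ hx ↦ hJ hx.1

/-- The cut-off vanishes off the tube. [folklore] -/
theorem cutoff_eq_zero_of_not_mem {T η ρ : ℝ} (hT : 0 ≤ T) (hη : 0 < η) (hρ : 0 < ρ) {x : E4}
    (hx : x ∉ D.tube T η ρ) : D.cutoff hT hη hρ x = 0 := by
  by_contra h
  rcases mul_ne_zero_iff.1 h with ⟨h1, h2⟩
  exact hx ⟨Ioo_subset_Icc_self (mem_Ioo_of_timeCut_ne_zero hT hη h1),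
    (norm_lt_of_spaceCut_ne_zero hρ h2).le⟩

/-- The cut-off is `C^∞`. [folklore] -/
theorem contDiff_cutoff {T η ρ : ℝ} (hT : 0 ≤ T) (hη : 0 < η) (hJ : Icc (-(3 * η)) (T + 3 * η) ⊆ J)
    (hρ : 0 < ρ) : ContDiff ℝ ∞ (D.cutoff hT hη hρ) := by
  have h1 : ContDiff ℝ ∞ fun x : E4 ↦ (timeCut hT hη : ℝ → ℝ) (x 0) :=
    (timeCut hT hη).contDiff.comp (EuclideanSpace.proj (𝕜 := ℝ) (0 : Fin 4)).contDiff
  have h1s : tsupport (fun x : E4 ↦ (timeCut hT hη : ℝ → ℝ) (x 0)) ⊆ {x : E4 | x 0 ∈ J} := by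
    have hcl : IsClosed {x : E4 | x 0 ∈ Icc (-(3 * η)) (T + 3 * η)} :=
      isClosed_Icc.preimage (EuclideanSpace.proj (𝕜 := ℝ) (0 : Fin 4)).continuous
    refine (closure_minimal (fun x hx ↦ ?_) hcl).trans fun x hx ↦ hJ hx
    exact Ioo_subset_Icc_self (mem_Ioo_of_timeCut_ne_zero hT hη hx)
  have hcJ : ContDiffOn ℝ ∞ (fun x : E4 ↦ D.c (x 0)) {x : E4 | x 0 ∈ J} :=
    ((contDiffOn_piLp 2).2 D.hc).comp (EuclideanSpace.proj (𝕜 := ℝ) (0 : Fin 4)).contDiff.contDiffOn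
      fun x hx ↦ hx
  have h2 : ContDiffOn ℝ ∞ (fun x : E4 ↦ (spaceCut hρ : E3 → ℝ) (E4.spatial x - D.c (x 0))) {x : E4 | x 0 ∈ J} :=
    (spaceCut hρ).contDiff.comp_contDiffOn (E4.spatial.contDiff.contDiffOn.sub hcJ)
  exact contDiff_mul_of_tsupport (isOpen_slab D.hJ) h1 h1s h2

/-- **The tube amplitude** `a(x) = χ_T(x⁰) χ_ρ(x⃗ − c(x⁰)) A₀(x⁰)`. [cite: Sbierski2015, §3 Def. 3.1 (`a_𝒩 = a·χ`)] -/
def tubeAmpFun {T η ρ : ℝ} (hT : 0 ≤ T) (hη : 0 < η) (hρ : 0 < ρ) (x : E4) : ℂ :=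
  (D.cutoff hT hη hρ x : ℂ) * D.A₀ (x 0)

/-- The tube amplitude vanishes off the tube. [folklore] -/
theorem tubeAmpFun_eq_zero_of_not_mem {T η ρ : ℝ} (hT : 0 ≤ T) (hη : 0 < η) (hρ : 0 < ρ) {x : E4}
    (hx : x ∉ D.tube T η ρ) : D.tubeAmpFun hT hη hρ x = 0 := by
  simp [tubeAmpFun, D.cutoff_eq_zero_of_not_mem hT hη hρ hx]

/-- `supp a ⊆` the tube. [folklore] -/
theorem tsupport_tubeAmpFun_subset {T η ρ : ℝ} (hT : 0 ≤ T) (hη : 0 < η)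
    (hJ : Icc (-(3 * η)) (T + 3 * η) ⊆ J) (hρ : 0 < ρ) :
    tsupport (D.tubeAmpFun hT hη hρ) ⊆ D.tube T η ρ :=
  closure_minimal (fun x hx ↦ by by_contra h; exact hx (D.tubeAmpFun_eq_zero_of_not_mem hT hη hρ h))
    (D.isCompact_tube hJ).isClosed

/-- The tube amplitude is `C^∞`. [folklore] -/
theorem contDiff_tubeAmpFun {T η ρ : ℝ} (hT : 0 ≤ T) (hη : 0 < η) (hJ : Icc (-(3 * η)) (T + 3 * η) ⊆ J)
    (hρ : 0 < ρ) : ContDiff ℝ ∞ (D.tubeAmpFun hT hη hρ) := by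
  have h1 : ContDiff ℝ ∞ fun x ↦ (D.cutoff hT hη hρ x : ℂ) :=
    Complex.ofRealCLM.contDiff.comp (D.contDiff_cutoff hT hη hJ hρ)
  have h1s : tsupport (fun x ↦ (D.cutoff hT hη hρ x : ℂ)) ⊆ {x : E4 | x 0 ∈ J} := by
    refine (closure_minimal (t := D.tube T η ρ) (fun x hx ↦ ?_) (D.isCompact_tube hJ).isClosed).trans
      (D.tube_subset_slab hJ)
    by_contra h
    exact hx (by simp [D.cutoff_eq_zero_of_not_mem hT hη hρ h])
  have h2 : ContDiffOn ℝ ∞ (fun x : E4 ↦ D.A₀ (x 0)) {x : E4 | x 0 ∈ J} :=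
    D.contDiffOn_A₀.comp (EuclideanSpace.proj (𝕜 := ℝ) (0 : Fin 4)).contDiff.contDiffOn fun x hx ↦ hx
  exact contDiff_mul_of_tsupport (isOpen_slab D.hJ) h1 h1s h2

/-- **The tube amplitude equals `A₀(x⁰)` near the curve over `(−η, T + η)`** (both cut-offs are
`1` near `X(t)`). [cite: Sbierski2015, §3 Def. 3.1 ("`χ ≡ 1` near `γ`")] -/
theorem tubeAmpFun_core {T η ρ : ℝ} (hT : 0 ≤ T) (hη : 0 < η) (hJ : Icc (-(3 * η)) (T + 3 * η) ⊆ J)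
    (hρ : 0 < ρ) {t : ℝ} (ht : t ∈ Ioo (-η) (T + η)) :
    D.tubeAmpFun hT hη hρ =ᶠ[𝓝 (D.X t)] fun y ↦ D.A₀ (y 0) := by
  have htJ : t ∈ J := hJ ⟨by linarith [ht.1], by linarith [ht.2]⟩
  -- the time cut-off is `1` near `X t`
  have h1 : ∀ᶠ y in 𝓝 (D.X t), (timeCut hT hη : ℝ → ℝ) (y 0) = 1 := by
    have hopen : IsOpen {y : E4 | y 0 ∈ Ioo (-(2 * η)) (T + 2 * η)} :=
      isOpen_Ioo.preimage (EuclideanSpace.proj (𝕜 := ℝ) (0 : Fin 4)).continuous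
    have hmem : D.X t ∈ {y : E4 | y 0 ∈ Ioo (-(2 * η)) (T + 2 * η)} := by
      simp only [mem_setOf_eq, D.X_apply_zero]
      exact ⟨by linarith [ht.1], by linarith [ht.2]⟩
    filter_upwards [hopen.mem_nhds hmem] with y hy
    exact timeCut_eq_one hT hη (Ioo_subset_Icc_self hy)
  -- the spatial cut-off is `1` near `X t`
  have h2 : ∀ᶠ y in 𝓝 (D.X t), (spaceCut hρ : E3 → ℝ) (E4.spatial y - D.c (y 0)) = 1 := by
    have hcont : ContinuousAt (fun y : E4 ↦ E4.spatial y - D.c (y 0)) (D.X t) := by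
      have hc : ContinuousAt (fun y : E4 ↦ D.c (y 0)) (D.X t) := by
        have hcJ : ContinuousOn (fun y : E4 ↦ D.c (y 0)) {x : E4 | x 0 ∈ J} :=
          D.continuousOn_c.comp (EuclideanSpace.proj (𝕜 := ℝ) (0 : Fin 4)).continuous.continuousOn
            fun x hx ↦ hx
        exact hcJ.continuousAt ((isOpen_slab D.hJ).mem_nhds (by simpa [BeamData.X] using htJ))
      exact E4.spatial.continuous.continuousAt.sub hc
    have hval : E4.spatial (D.X t) - D.c ((D.X t) 0) = 0 := by simp [BeamData.X]
    have hball : ∀ᶠ y in 𝓝 (D.X t), E4.spatial y - D.c (y 0) ∈ ball (0 : E3) ρ :=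
      hcont.preimage_mem_nhds (by rw [hval]; exact ball_mem_nhds _ hρ)
    filter_upwards [hball] with y hy
    exact spaceCut_eq_one hρ (by rw [mem_ball, dist_zero_right] at hy; exact hy.le)
  filter_upwards [h1, h2] with y hy1 hy2
  simp [tubeAmpFun, cutoff, hy1, hy2]

/-- **The admissible tube amplitude** as a `BeamAmp D T`. [cite: Sbierski2015, §3 Def. 3.1] -/
def tubeAmp {T η ρ : ℝ} (hT : 0 ≤ T) (hη : 0 < η) (hJ : Icc (-(3 * η)) (T + 3 * η) ⊆ J) (hρ : 0 < ρ)
    (hVt : ∀ x : E4, x 0 ∈ Icc (-(3 * η)) (T + 3 * η) → ‖E4.spatial x - D.c (x 0)‖ ≤ 2 * ρ → x ∈ V) :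
    BeamAmp D T where
  amp := D.tubeAmpFun hT hη hρ
  η := η
  hη := hη
  hT0 := hT
  hTη := fun t ht ↦ hJ ⟨by linarith [ht.1], by linarith [ht.2]⟩
  smooth := D.contDiff_tubeAmpFun hT hη hJ hρ
  compact := IsCompact.of_isClosed_subset (D.isCompact_tube hJ) (isClosed_tsupport _)
    (D.tsupport_tubeAmpFun_subset hT hη hJ hρ)
  tsupp := fun x hx ↦
    have hx' := D.tsupport_tubeAmpFun_subset hT hη hJ hρ hx
    ⟨hVt x hx'.1 hx'.2, D.tube_subset_slab hJ hx'⟩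
  core := fun t ht ↦ D.tubeAmpFun_core hT hη hJ hρ ht

/-- **The tube beam is supported in the tube.** [cite: Sbierski2015, §3 Def. 3.1 (`supp a_𝒩 ⊆ 𝒩`)] -/
theorem tsupport_tubeAmp_subset {T η ρ : ℝ} (hT : 0 ≤ T) (hη : 0 < η) (hJ : Icc (-(3 * η)) (T + 3 * η) ⊆ J)
    (hρ : 0 < ρ)
    (hVt : ∀ x : E4, x 0 ∈ Icc (-(3 * η)) (T + 3 * η) → ‖E4.spatial x - D.c (x 0)‖ ≤ 2 * ρ → x ∈ V) :
    tsupport (D.tubeAmp hT hη hJ hρ hVt).amp ⊆ D.tube T η ρ :=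
  D.tsupport_tubeAmpFun_subset hT hη hJ hρ

/-! ### The thinness sets -/

/-- **The set where `T = (G Re dφ)⁰` is `δ`-close to `κ(x⁰)`** (open, contains the curve).
[cite: Sbierski2015, §4 (proof of the theorem: `𝒩₁(δ)`)] -/
def goodδ (δ : ℝ) : Set E4 := (V ∩ {x : E4 | x 0 ∈ J}) ∩ {x : E4 | |D.tCo x - D.κ (x 0)| < δ}

/-- `goodδ` is open. [folklore] -/
theorem isOpen_goodδ (δ : ℝ) : IsOpen (D.goodδ δ) := by
  have hf : ContinuousOn (fun x ↦ |D.tCo x - D.κ (x 0)|) (V ∩ {x : E4 | x 0 ∈ J}) := by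
    refine ((D.contDiffOn_Wc 0).continuousOn.sub ?_).abs
    exact (D.hκ.continuousOn.comp (EuclideanSpace.proj (𝕜 := ℝ) (0 : Fin 4)).continuous.continuousOn
      fun x hx ↦ hx).mono inter_subset_right
  exact hf.isOpen_inter_preimage D.isOpen_inter_slab isOpen_Iio

/-- The curve lies in `goodδ` for `δ > 0`. [folklore] -/
theorem X_mem_goodδ {δ : ℝ} (hδ : 0 < δ) {t : ℝ} (ht : t ∈ J) : D.X t ∈ D.goodδ δ := by
  refine ⟨D.X_mem ht, ?_⟩
  simp only [mem_setOf_eq, D.X_apply_zero, D.tCo_X ht, sub_self, abs_zero]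
  exact hδ

/-- **The spatial momentum** `P⃗(t) = (P₁, P₂, P₃)(t)`. [cite: Sbierski2015, §3 (`dφ|_γ = γ̇♭`)] -/
def Psp (t : ℝ) : E3 := WithLp.toLp 2 fun i ↦ D.P t i.succ

/-- Components of `P⃗`. [folklore] -/
@[simp] theorem Psp_apply (t : ℝ) (i : Fin 3) : D.Psp t i = D.P t i.succ := rfl

/-- **`P⃗ ≠ 0` on `J`** (a null covector with `P·Ẋ = 0`, `Ẋ⁰ = 1`, `g⁻¹P = κẊ ≠ 0`). [folklore] -/
theorem Psp_ne_zero {t : ℝ} (ht : t ∈ J) : D.Psp t ≠ 0 := by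
  intro h
  have hsp : ∀ i : Fin 3, D.P t i.succ = 0 := fun i ↦ by
    have := congrArg (fun v : E3 ↦ v i) h
    simpa using this
  have h0 : D.P t 0 = 0 := by
    have := D.hPX t ht
    simpa [hsp] using this
  have hP : ∀ ν, D.P t ν = 0 := fun ν ↦ Fin.cases h0 hsp ν
  have hv := D.hvel t ht 0
  simp only [hP, mul_zero, Finset.sum_const_zero, xdot, Fin.cases_zero, mul_one] at hv
  exact (D.hκpos t ht).ne' hv.symm

/-- **The directions** `Z(t) = P⃗(t)/|P⃗(t)|²`, so that `Re ∂_{Z(t)}φ(X(t)) = P⃗·Z = 1`.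
[cite: Sbierski2015, §4 (third remark: non-stationarity of `Re φ` transversally, `dφ|_γ = γ̇♭ ≠ 0`)] -/
def Zdir (t : ℝ) : E3 := (‖D.Psp t‖ ^ 2)⁻¹ • D.Psp t

/-- `P⃗` is continuous on `J`. [folklore] -/
theorem continuousOn_Psp : ContinuousOn D.Psp J := by
  rw [show D.Psp = fun t ↦ WithLp.toLp 2 (fun i ↦ D.P t i.succ) from rfl]
  refine (PiLp.continuous_toLp 2 _).comp_continuousOn ?_
  exact continuousOn_pi.2 fun i ↦ (D.hP i.succ).continuousOn

/-- `Z` is continuous on `J`. [folklore] -/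
theorem continuousOn_Zdir : ContinuousOn D.Zdir J := by
  have hinv : ContinuousOn (fun t ↦ (‖D.Psp t‖ ^ 2)⁻¹) J :=
    ((D.continuousOn_Psp.norm).pow 2).inv₀ fun t ht ↦ (pow_pos (norm_pos_iff.2 (D.Psp_ne_zero ht)) 2).ne'
  exact hinv.smul D.continuousOn_Psp

/-- `Z` is bounded on compact subintervals of `J`. [folklore] -/
theorem exists_norm_Zdir_le {a b : ℝ} (hab : Icc a b ⊆ J) : ∃ Zb : ℝ, ∀ t ∈ Icc a b, ‖D.Zdir t‖ ≤ Zb := by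
  obtain ⟨Zb, hZb⟩ := isCompact_Icc.exists_bound_of_continuousOn (D.continuousOn_Zdir.mono hab)
  exact ⟨Zb, hZb⟩

/-- **`Re dφ(x)(0, v) = ∑_i v_i Re ∂_{i+1}φ(x)`.** [folklore] -/
theorem re_fderiv_φ_spaceEmbed (x : E4) (v : E3) :
    (fderiv ℝ D.φ x (E4.spaceEmbed v)).re = ∑ i : Fin 3, v i * (dC D.φ x i.succ).re := by
  rw [fderiv_apply_eq_sum_dC D.φ x (E4.spaceEmbed v), Complex.re_sum, Fin.sum_univ_succ]
  simp [E4.spaceEmbed_apply]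

/-- **On the curve `Re ∂_{Z(t)}φ(X(t)) = 1`.** [cite: Sbierski2015, §4 (third remark)] -/
theorem re_fderiv_φ_X_Zdir {t : ℝ} (ht : t ∈ J) :
    (fderiv ℝ D.φ (D.X t) (E4.spaceEmbed (D.Zdir t))).re = 1 := by
  rw [D.re_fderiv_φ_spaceEmbed]
  have hre : ∀ ν, (dC D.φ (D.X t) ν).re = D.P t ν := fun ν ↦ by
    rw [BeamData.φ, dC_phase D.P D.M D.c D.hJ D.hP D.hM D.hc (by simpa [BeamData.X] using ht) ν,
      BeamData.X, dphase_curve D.P D.M D.c t (D.hPX t ht), Complex.ofReal_re]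
  simp only [hre, Zdir, PiLp.smul_apply, smul_eq_mul, Psp_apply]
  have hn : ‖D.Psp t‖ ^ 2 = ∑ i : Fin 3, D.P t i.succ * D.P t i.succ := by
    rw [EuclideanSpace.norm_sq_eq]
    exact Finset.sum_congr rfl fun i _ ↦ by rw [Psp_apply, Real.norm_eq_abs, sq_abs, sq]
  have hpos : 0 < ‖D.Psp t‖ ^ 2 := pow_pos (norm_pos_iff.2 (D.Psp_ne_zero ht)) 2
  calc ∑ i : Fin 3, (‖D.Psp t‖ ^ 2)⁻¹ * D.P t i.succ * D.P t i.succ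
      = (‖D.Psp t‖ ^ 2)⁻¹ * ∑ i : Fin 3, D.P t i.succ * D.P t i.succ := by
        rw [Finset.mul_sum]; exact Finset.sum_congr rfl fun i _ ↦ by ring
    _ = 1 := by rw [← hn, inv_mul_cancel₀ hpos.ne']

/-- **The set where `Re ∂_{Z(x⁰)}φ(x) > ½`** (open, contains the curve).
[cite: Sbierski2015, §4 (third remark)] -/
def goodZ : Set E4 :=
  (V ∩ {x : E4 | x 0 ∈ J}) ∩ {x : E4 | 2⁻¹ < (fderiv ℝ D.φ x (E4.spaceEmbed (D.Zdir (x 0)))).re}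

/-- `goodZ` is open. [folklore] -/
theorem isOpen_goodZ : IsOpen D.goodZ := by
  have hf : ContinuousOn (fun x ↦ (fderiv ℝ D.φ x (E4.spaceEmbed (D.Zdir (x 0)))).re)
      (V ∩ {x : E4 | x 0 ∈ J}) := by
    have hfun : (fun x ↦ (fderiv ℝ D.φ x (E4.spaceEmbed (D.Zdir (x 0)))).re) =
        fun x ↦ ∑ i : Fin 3, D.Zdir (x 0) i * (dC D.φ x i.succ).re :=
      funext fun x ↦ D.re_fderiv_φ_spaceEmbed x _
    rw [hfun]
    refine continuousOn_finsetSum _ fun i _ ↦ ContinuousOn.mul ?_ ?_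
    · have hZ : ContinuousOn (fun x : E4 ↦ D.Zdir (x 0)) {x : E4 | x 0 ∈ J} :=
        D.continuousOn_Zdir.comp (EuclideanSpace.proj (𝕜 := ℝ) (0 : Fin 4)).continuous.continuousOn
          fun x hx ↦ hx
      exact ((EuclideanSpace.proj (𝕜 := ℝ) i).continuous.comp_continuousOn hZ).mono inter_subset_right
    · exact (Complex.continuous_re.comp_continuousOn (D.contDiffOn_dC_φ i.succ).continuousOn).mono
        inter_subset_right
  exact hf.isOpen_inter_preimage D.isOpen_inter_slab isOpen_Ioi

/-- The curve lies in `goodZ`. [folklore] -/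
theorem X_mem_goodZ {t : ℝ} (ht : t ∈ J) : D.X t ∈ D.goodZ := by
  refine ⟨D.X_mem ht, ?_⟩
  simp only [mem_setOf_eq, D.X_apply_zero, D.re_fderiv_φ_X_Zdir ht]
  norm_num

/-! ### Existence of thin admissible amplitudes -/

/-- **Thin admissible amplitudes exist.** For beam data over an interval `J ⊇ [−3η, T + 3η]`,
`T ≥ 0`, `η > 0`, every open `W` containing the curve `X([−3η, T+3η])` and every `δ > 0`, there
is an admissible amplitude `A : BeamAmp D T` with `supp a ⊆ W`, with `|T − κ(τ)| ≤ δ` on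
`supp a ∩ Σ_τ` and `Re ∂_{Z(τ)}(φ(τ, ·)) ≥ ½` on `supp a ∩ Σ_τ` for `0 ≤ τ ≤ T`, the directions
`Z` being bounded on `[0, T]` ("choose `𝒩₁(δ)` so small that …"; `χ ≡ 1` near `γ`,
`supp a_𝒩 ⊆ 𝒩`). [cite: Sbierski2015, §3 Def. 3.1 and §4 (proof of the theorem, choice of `𝒩₁(δ)`)] -/
theorem exists_beamAmp {T η : ℝ} (hT : 0 ≤ T) (hη : 0 < η) (hJ : Icc (-(3 * η)) (T + 3 * η) ⊆ J)
    {W : Set E4} (hW : IsOpen W) (hXW : ∀ t ∈ Icc (-(3 * η)) (T + 3 * η), D.X t ∈ W)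
    {δ : ℝ} (hδ : 0 < δ) :
    ∃ A : BeamAmp D T, tsupport A.amp ⊆ W ∧
      (∀ τ ∈ Icc (0 : ℝ) T, ∀ y : E3, E4.ofTimeSpace τ y ∈ tsupport A.amp →
        |D.tCo (E4.ofTimeSpace τ y) - D.κ τ| ≤ δ) ∧
      ∃ Z : ℝ → E3, ∃ Zb : ℝ, (∀ τ ∈ Icc (0 : ℝ) T, ‖Z τ‖ ≤ Zb) ∧
        ∀ τ ∈ Icc (0 : ℝ) T, ∀ y : E3, E4.ofTimeSpace τ y ∈ tsupport A.amp →
          2⁻¹ ≤ (fderiv ℝ (fun y ↦ D.φ (E4.ofTimeSpace τ y)) y (Z τ)).re := by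
  -- one open set carrying all the requirements
  set O : Set E4 := ((W ∩ V) ∩ D.goodδ δ) ∩ D.goodZ with hO
  have hOo : IsOpen O := ((hW.inter D.hV).inter (D.isOpen_goodδ δ)).inter D.isOpen_goodZ
  have hXO : ∀ t ∈ Icc (-(3 * η)) (T + 3 * η), D.X t ∈ O := fun t ht ↦
    ⟨⟨⟨hXW t ht, D.hXV t (hJ ht)⟩, D.X_mem_goodδ hδ (hJ ht)⟩, D.X_mem_goodZ (hJ ht)⟩
  obtain ⟨ρ, hρ, hρO⟩ := D.exists_tube_radius hJ hOo hXO
  have hVt : ∀ x : E4, x 0 ∈ Icc (-(3 * η)) (T + 3 * η) → ‖E4.spatial x - D.c (x 0)‖ ≤ 2 * ρ → x ∈ V :=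
    fun x hx hx' ↦ (hρO x hx hx').1.1.2
  set A : BeamAmp D T := D.tubeAmp hT hη hJ hρ hVt with hA
  have hsub : ∀ x ∈ tsupport A.amp, x ∈ O := fun x hx ↦ by
    have h := D.tsupport_tubeAmp_subset hT hη hJ hρ hVt hx
    exact hρO x h.1 h.2
  obtain ⟨Zb, hZb⟩ := D.exists_norm_Zdir_le ((Set.Icc_subset_Icc (by linarith) (by linarith)).trans hJ :
    Icc (0 : ℝ) T ⊆ J)
  refine ⟨A, fun x hx ↦ (hsub x hx).1.1.1, fun τ hτ y hy ↦ ?_, D.Zdir, Zb, hZb, fun τ hτ y hy ↦ ?_⟩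
  · have h := (hsub _ hy).1.2.2
    simp only [mem_setOf_eq, E4.ofTimeSpace_apply_zero] at h
    exact h.le
  · have hτJ : τ ∈ J := hJ ⟨by linarith [hτ.1], by linarith [hτ.2]⟩
    have h := (hsub _ hy).2.2
    simp only [mem_setOf_eq, E4.ofTimeSpace_apply_zero] at h
    rw [D.fderiv_φ_slice hτJ]
    exact h.le

end BeamData

end GaussianBeam

end Literature.Geometry.Lorentzian
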